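import Summits.CriticalPhenomena.SAWScalingLimit.Theorems.MassRatio.Negative.RowsB
import Summits.CriticalPhenomena.SAWScalingLimit.Theorems.MassRatio.Negative.Component
import Summits.CriticalPhenomena.SAWScalingLimit.Theorems.SAWDefectDecoherenceMassRatioRenewalDefs
import Literature.Probability.RandomPlanarGeometry.HexSAWBridgeDecay

/-!
# Crux `SAWDefectDecoherence.MassRatio` (stmt-CriticalPhenomena-8550), line `renewal-averaging-at-b`:
# the bridge dictionary, part A — kernel laws (translation, window monotonicity, parity)

Part A of the proof of the registered stub `stub_bridgeDictionary : BridgeDictionary kernel HV.stripBlim`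
(vocabulary: `Theorems/SAWDefectDecoherenceMassRatioRenewalDefs.lean`; part B,
`…RenewalDictionaryB.lean`, identifies box bridges at the door `(0,0)` with the DCS strip bridges and
assembles the stub).  Here, for the renewal kernel `kernel m p t W h j` (the `x_c`-mass of the
self-avoiding walks inside `box m p h W` from `top m p h j` down to `door m p` with no renewal
level in `[t, h)`):

* (i) TRANSLATION (`kernel_transl`, registered sub-goal `stub_bridgeDictionary_transl`): for
  `(p - m) % 2 = 0` the door translation `v ↦ bv (row v - m) (pos v - p)` is a graph automorphism
  of `ℍ` (`transl`: adjacency only sees coordinate differences and the parity of `pos - row`)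
  carrying `box m p h W`, `top m p h j`, `door m p` onto the objects at the door `(0,0)` and box
  walks onto box walks (`mapSAW`, `translEquiv`) with the same length and the same renewal levels
  (`splits_map_iff`), whence `kernel m p = kernel 0 0`;
* (ii) MONOTONICITY in the window (`kernel_mono_W`): `ofSubdomain` along `box_mono_W` is an
  injection preserving the vertex list, and the terms are `≥ 0`;
* (v) PARITY (`kernel_eq_zero_of_parity`): no walk starts at `top m p h j` unless it is an edge of
  `ℍ`, i.e. `(p + j - (m + h)) % 2 = 0` (`adj_top_iff`).

Sources: H. Kesten, J. Math. Phys. 4 (1963); N. Madras, G. Slade, *The Self-Avoiding Walk* (1993)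
§4.2; the line card `Cruxes/MassRatio/Lines/renewal-averaging-at-b.md`.
-/

noncomputable section

namespace Summit.CriticalPhenomena.SAWScalingLimit.Theorems.MassRatio.Renewal

open Literature.Probability.LatticeModels Literature.Probability.RandomPlanarGeometry
open Literature.Probability.RandomPlanarGeometry.SAW
open Summit.CriticalPhenomena.SAWScalingLimit.Theorems.MassRatio.Negative

namespace BridgeDictionary
/-! ### Lattice facts about boxes, tops and doors -/

/-- The top edge at offset `j` is an edge of `ℍ` iff the parity fits. [folklore] -/
theorem adj_top_iff {m p : ℤ} {h : ℕ} {j : ℤ} :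
    hexGraph.Adj (bv (m + h) (p + j)) (bv (m + h - 1) (p + j)) ↔ (p + j - (m + h)) % 2 = 0 := by
  rw [adj_bv_iff]
  constructor
  · rintro (⟨h1, -⟩ | ⟨-, -, h3⟩ | ⟨-, h2, -⟩)
    · omega
    · exact h3
    · omega
  · intro h3
    exact Or.inr (Or.inl ⟨rfl, by ring, h3⟩)

/-- Membership in the box. [folklore] -/
theorem mem_box {m p : ℤ} {h W : ℕ} {v : HexVertex} :
    v ∈ box m p h W ↔ m ≤ row v ∧ row v ≤ m + h - 1 ∧ p - W ≤ pos v ∧ pos v ≤ p + W := mem_Rect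

/-- Boxes increase with the window. [folklore] -/
theorem box_mono_W {m p : ℤ} {h W W' : ℕ} (hW : W ≤ W') : box m p h W ⊆ box m p h W' := by
  intro v hv
  rw [mem_box] at hv ⊢
  omega

/-- `top ≠ door` for `h ≥ 1` (so box walks `top → door` are nonempty lists). [folklore] -/
theorem top_ne_door {m p : ℤ} {h : ℕ} {j : ℤ} (hh : 1 ≤ h) : top m p h j ≠ door m p := by
  intro heq
  have : bv (m + h) (p + j) ∈ door m p := by rw [← heq, top]; exact Sym2.mem_mk_left _ _
  rw [door, Sym2.mem_iff] at this
  rcases this with h1 | h1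
  · have := (bv_inj h1).1; omega
  · have := (bv_inj h1).1; omega

/-- Two vertical pairs of brick vertices with equal coordinates are equal. [folklore] -/
theorem mk_bv_eq {a b c d a' b' c' d' : ℤ} (h1 : a = a') (h2 : b = b') (h3 : c = c')
    (h4 : d = d') : s(bv a b, bv c d) = s(bv a' b', bv c' d') := by
  subst h1 h2 h3 h4; rfl

/-! ### (v) No walk starts at a non-edge -/

/-- The kernel vanishes when the top mid-edge is not an edge of `ℍ`: a box walk needs
`top ∈ hexGraph.edgeSet` (`fst_mem`). [folklore] -/
theorem kernel_eq_zero_of_parity {m p : ℤ} {t W h : ℕ} {j : ℤ}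
    (hpar : (p + j - (m + h)) % 2 ≠ 0) : kernel m p t W h j = 0 := by
  haveI : IsEmpty (HexMidEdgeSAW (box m p h W) (top m p h j) (door m p)) :=
    ⟨fun β => hpar (adj_top_iff.1 ((SimpleGraph.mem_edgeSet _).1 β.fst_mem.1))⟩
  unfold kernel
  exact Fintype.sum_empty _

/-! ### (ii) Monotonicity in the window -/

open scoped Classical in
/-- The kernel increases with the window `W`: box walks of the smaller box are box walks of the
larger one (`ofSubdomain`), with the same vertices. [folklore] -/
theorem kernel_mono_W (m p : ℤ) (t : ℕ) {W W' : ℕ} (h : ℕ) (j : ℤ) (hW : W ≤ W') :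
    kernel m p t W h j ≤ kernel m p t W' h j := by
  unfold kernel
  set ι : HexMidEdgeSAW (box m p h W) (top m p h j) (door m p) →
      HexMidEdgeSAW (box m p h W') (top m p h j) (door m p) := ofSubdomain (box_mono_W hW) with hι
  have hinj : Function.Injective ι := fun β β' hββ' =>
    HexMidEdgeSAW.ext (by simpa [hι, ofSubdomain] using congrArg HexMidEdgeSAW.verts hββ')
  set F : HexMidEdgeSAW (box m p h W') (top m p h j) (door m p) → ℝ := fun β' =>
    if NoSplit m t h β'.verts then hexCriticalFugacity ^ β'.length else 0 with hF
  have hF0 : ∀ β', 0 ≤ F β' := fun β' => by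
    simp only [hF]
    split_ifs
    · exact pow_nonneg hexCriticalFugacity_pos_lt_one.1.le _
    · exact le_rfl
  have h1 : (∑ β : HexMidEdgeSAW (box m p h W) (top m p h j) (door m p),
      (if NoSplit m t h β.verts then hexCriticalFugacity ^ β.length else 0)) = ∑ β, F (ι β) :=
    Finset.sum_congr rfl fun β _ => rfl
  have h2 : ∑ β, F (ι β) = ∑ β' ∈ Finset.univ.map ⟨ι, hinj⟩, F β' :=
    (Finset.sum_map Finset.univ ⟨ι, hinj⟩ F).symm
  rw [h1, h2]
  exact Finset.sum_le_sum_of_subset_of_nonneg (Finset.subset_univ _) fun β' _ _ => hF0 β'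

/-! ### (i) Door translations -/

/-- The door translation `(m, p) ↦ (0, 0)`, `v ↦ bv (row v - m) (pos v - p)`: a graph automorphism
of `ℍ` when `(p - m) % 2 = 0` (adjacency only sees coordinate differences and the parity of
`pos - row`). [folklore] -/
def transl (m p : ℤ) (hmp : (p - m) % 2 = 0) : hexGraph ≃g hexGraph where
  toEquiv :=
    { toFun := fun v => bv (row v - m) (pos v - p)
      invFun := fun v => bv (row v + m) (pos v + p)
      left_inv := fun v => by simp only [row_bv, pos_bv, sub_add_cancel, bv_row_pos]
      right_inv := fun v => by simp only [row_bv, pos_bv, add_sub_cancel_right, bv_row_pos] }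
  map_rel_iff' := by
    intro u v
    simp only [Equiv.coe_fn_mk, adj_bv_iff]
    rw [adj_iff u v]
    omega

/-- `transl` in coordinates. [folklore] -/
theorem transl_apply {m p : ℤ} (hmp : (p - m) % 2 = 0) (v : HexVertex) :
    transl m p hmp v = bv (row v - m) (pos v - p) := rfl

/-- The inverse translation in coordinates. [folklore] -/
theorem transl_symm_apply {m p : ℤ} (hmp : (p - m) % 2 = 0) (v : HexVertex) :
    (transl m p hmp).symm v = bv (row v + m) (pos v + p) := rfl

/-- An automorphism of `ℍ` maps edges to edges. [folklore] -/
theorem map_mem_edgeSet (φ : hexGraph ≃g hexGraph) :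
    ∀ e : Sym2 HexVertex, e ∈ hexGraph.edgeSet → e.map φ ∈ hexGraph.edgeSet := by
  intro e
  induction e using Sym2.ind with
  | h x y =>
    intro he
    rw [Sym2.map_mk]
    exact (SimpleGraph.mem_edgeSet _).2 (φ.map_rel_iff.2 ((SimpleGraph.mem_edgeSet _).1 he))

/-- The consecutive-pair list of a mapped vertex list. [folklore] -/
theorem edgeList_map (f : HexVertex → HexVertex) (l : List HexVertex) :
    List.zipWith (fun u w => s(u, w)) (l.map f) (l.map f).tail =
      (List.zipWith (fun u w => s(u, w)) l l.tail).map (Sym2.map f) := by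
  rw [← List.map_tail, List.zipWith_map, List.map_zipWith]
  rfl

/-- Transport of a mid-edge self-avoiding walk along an automorphism of `ℍ` mapping the domain
into the new domain and the two mid-edges onto the new ones (field by field). [folklore] -/
def mapSAW (φ : hexGraph ≃g hexGraph) {Λ Λ' : Finset HexVertex} {a z a' z' : Sym2 HexVertex}
    (hΛ : ∀ v ∈ Λ, φ v ∈ Λ') (ha : a.map φ = a') (hz : z.map φ = z')
    (γ : HexMidEdgeSAW Λ a z) : HexMidEdgeSAW Λ' a' z' where
  verts := γ.verts.map φ
  subset := by
    intro v hv
    obtain ⟨w, hw, rfl⟩ := List.mem_map.1 hv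
    exact hΛ w (γ.subset w hw)
  nodup := γ.nodup.map φ.injective
  isChain := (List.isChain_map _).2 (γ.isChain.imp fun u w huw => φ.map_rel_iff.2 huw)
  head_mem := by
    intro v hv
    rw [List.head?_map, Option.map_eq_some_iff] at hv
    obtain ⟨w, hw, rfl⟩ := hv
    rw [← ha]
    exact Sym2.mem_map.2 ⟨w, γ.head_mem w hw, rfl⟩
  getLast_mem := by
    intro v hv
    rw [List.getLast?_map, Option.map_eq_some_iff] at hv
    obtain ⟨w, hw, rfl⟩ := hv
    rw [← hz]
    exact Sym2.mem_map.2 ⟨w, γ.getLast_mem w hw, rfl⟩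
  eq_of_nil := fun h => by rw [← ha, ← hz, γ.eq_of_nil (List.map_eq_nil_iff.1 h)]
  edges_nodup := fun hne => by
    have hne' : γ.verts ≠ [] := fun h => hne (by rw [h]; rfl)
    have key : a' :: List.zipWith (fun u w => s(u, w)) (γ.verts.map φ) (γ.verts.map φ).tail ++
        [z'] = (a :: List.zipWith (fun u w => s(u, w)) γ.verts γ.verts.tail ++ [z]).map
          (Sym2.map φ) := by
      rw [edgeList_map, ← ha, ← hz]
      simp
    rw [key]
    exact (γ.edges_nodup hne').map (Sym2.map.injective φ.injective)
  fst_mem := by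
    obtain ⟨he, v, hv, hvΛ⟩ := γ.fst_mem
    refine ⟨?_, φ v, ?_, hΛ v hvΛ⟩
    · rw [← ha]; exact map_mem_edgeSet φ a he
    · rw [← ha]; exact Sym2.mem_map.2 ⟨v, hv, rfl⟩

/-- The vertices of a transported walk. [folklore] -/
@[simp] theorem mapSAW_verts (φ : hexGraph ≃g hexGraph) {Λ Λ' : Finset HexVertex}
    {a z a' z' : Sym2 HexVertex} (hΛ : ∀ v ∈ Λ, φ v ∈ Λ') (ha : a.map φ = a')
    (hz : z.map φ = z') (γ : HexMidEdgeSAW Λ a z) :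
    (mapSAW φ hΛ ha hz γ).verts = γ.verts.map φ := rfl

/-- Renewal levels are transported by a row-shifting relabelling of the vertices. [folklore] -/
theorem splits_map_iff {f : HexVertex → HexVertex} {c m m' : ℤ} (hf : ∀ v, row (f v) + c = row v)
    (hm : m' + c = m) (h' : ℕ) (l : List HexVertex) :
    Splits m' h' (l.map f) ↔ Splits m h' l := by
  constructor
  · rintro ⟨L₁, L₂, hL, h1, h2⟩
    obtain ⟨l₁, l₂, rfl, rfl, rfl⟩ := List.map_eq_append_iff.1 hL
    refine ⟨l₁, l₂, rfl, fun v hv => ?_, fun v hv => ?_⟩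
    · have := h1 (f v) (List.mem_map_of_mem hv); have := hf v; omega
    · have := h2 (f v) (List.mem_map_of_mem hv); have := hf v; omega
  · rintro ⟨l₁, l₂, rfl, h1, h2⟩
    refine ⟨l₁.map f, l₂.map f, List.map_append, fun v hv => ?_, fun v hv => ?_⟩
    · obtain ⟨w, hw, rfl⟩ := List.mem_map.1 hv; have := h1 w hw; have := hf w; omega
    · obtain ⟨w, hw, rfl⟩ := List.mem_map.1 hv; have := h2 w hw; have := hf w; omega

/-- `NoSplit` is transported by a row-shifting relabelling of the vertices. [folklore] -/
theorem noSplit_map_iff {f : HexVertex → HexVertex} {c m m' : ℤ} (hf : ∀ v, row (f v) + c = row v)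
    (hm : m' + c = m) (t h : ℕ) (l : List HexVertex) :
    NoSplit m' t h (l.map f) ↔ NoSplit m t h l := by
  unfold NoSplit
  simp only [splits_map_iff hf hm]

/-- The door translation carries box walks at the door `(m, p)` bijectively to box walks at the
door `(0, 0)`. [folklore] -/
def translEquiv {m p : ℤ} (hmp : (p - m) % 2 = 0) (W h : ℕ) (j : ℤ) :
    HexMidEdgeSAW (box m p h W) (top m p h j) (door m p) ≃
      HexMidEdgeSAW (box 0 0 h W) (top 0 0 h j) (door 0 0) where
  toFun := mapSAW (transl m p hmp)
    (fun v hv => by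
      rw [mem_box] at hv ⊢; rw [transl_apply, row_bv, pos_bv]; omega)
    (by
      simp only [top, Sym2.map_mk, transl_apply, row_bv, pos_bv]
      exact mk_bv_eq (by ring) (by ring) (by ring) (by ring))
    (by
      simp only [door, Sym2.map_mk, transl_apply, row_bv, pos_bv]
      exact mk_bv_eq (by ring) (by ring) (by ring) (by ring))
  invFun := mapSAW (transl m p hmp).symm
    (fun v hv => by
      rw [mem_box] at hv ⊢; rw [transl_symm_apply, row_bv, pos_bv]; omega)
    (by
      simp only [top, Sym2.map_mk, transl_symm_apply, row_bv, pos_bv]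
      exact mk_bv_eq (by ring) (by ring) (by ring) (by ring))
    (by
      simp only [door, Sym2.map_mk, transl_symm_apply, row_bv, pos_bv]
      exact mk_bv_eq (by ring) (by ring) (by ring) (by ring))
  left_inv γ := HexMidEdgeSAW.ext (by
    simp only [mapSAW_verts, List.map_map]
    exact List.map_id'' (fun v => (transl m p hmp).symm_apply_apply v) _)
  right_inv γ := HexMidEdgeSAW.ext (by
    simp only [mapSAW_verts, List.map_map]
    exact List.map_id'' (fun v => (transl m p hmp).apply_symm_apply v) _)

/-- The vertices of a translated box walk. [folklore] -/
theorem translEquiv_verts {m p : ℤ} (hmp : (p - m) % 2 = 0) (W h : ℕ) (j : ℤ)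
    (β : HexMidEdgeSAW (box m p h W) (top m p h j) (door m p)) :
    (translEquiv hmp W h j β).verts = β.verts.map (transl m p hmp) := rfl

open scoped Classical in
/-- (i) Door-translation invariance of the kernel. [folklore] -/
theorem kernel_transl {m p : ℤ} (hmp : (p - m) % 2 = 0) (t W h : ℕ) (j : ℤ) :
    kernel m p t W h j = kernel 0 0 t W h j := by
  unfold kernel
  have hrow : ∀ v, row (transl m p hmp v) + m = row v := fun v => by
    rw [transl_apply, row_bv]; ring
  refine Fintype.sum_equiv (translEquiv hmp W h j) _ _ fun β => ?_
  have hlen : (translEquiv hmp W h j β).length = β.length := by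
    simp only [HexMidEdgeSAW.length, translEquiv_verts, List.length_map]
  rw [hlen, translEquiv_verts]
  by_cases hns : NoSplit m t h β.verts
  · rw [if_pos hns, if_pos ((noSplit_map_iff hrow (zero_add m) t h β.verts).2 hns)]
  · rw [if_neg hns, if_neg (mt (noSplit_map_iff hrow (zero_add m) t h β.verts).1 hns)]

end BridgeDictionary

/-- **Registered sub-goal of `stub_bridgeDictionary` (part A)** — door-translation invariance of
the renewal kernel: conjunct (i) of `BridgeDictionary kernel HV.stripBlim`. [folklore] -/
theorem stub_bridgeDictionary_transl : ∀ (m p : ℤ) (t W h : ℕ) (j : ℤ), (p - m) % 2 = 0 → kernel m p t W h j = kernel 0 0 t W h j :=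
  fun _ _ t W h j hmp => BridgeDictionary.kernel_transl hmp t W h j

end Summit.CriticalPhenomena.SAWScalingLimit.Theorems.MassRatio.Renewal
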